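import Summits.QuantumFields.BalabanUV.Beta.D1BFx.BlockMeanBlindness
import Summits.QuantumFields.BalabanUV.Beta.D1BFx.FirstStepPinned

/-!
# Road BF-x, K-R1-SPEC v2 (D-Π) part 2: THE GAUGE TERM DROPS OUT OF THE HESSIAN KERNEL OVER `Π_bm`-DRESSED JETS, and — CONDITIONAL on the
# SHAPE of the dictionary (D-Γ) `KInv n = K_R − d∘X∘δ` (NOT asserted) — the first step of the literal of record ∕ the one-shot kernel of record
# `TshotOf Lc (JcPin …) m` IS the Hessian kernel over the R-weighted legs `K_R` with the literal's own (dressed) jets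

HONEST DEPENDENCY (page 1, mandatory): continuum YM on T⁴ ⇐ BetaPertH ∧ nine spine estimates (0/9 proved); BetaPertH ⇐ (D1) ∧ (D4) ∧
CAP+tail; G-an2-4 gates asym, D1 and NE2/3/4.  HONEST FRAMING (cell contract, verbatim): «discharging `BetaPertH` makes Bałaban's UV
stability UNCONDITIONAL — a real constructive-QFT result; it is NOT the continuum limit and NOT the Clay problem.»  THIS MODULE is [folklore]
composition BY NAME of part 1 (`BlockMeanBlindness.coDressKBmAt_sub_biGrad` ∕ `…_sub_of_gradCols`), an2's dressing adjunction
`AxialDressingRootedBmHessian.hessKer_dressBmAt` and the owner's `FirstStepPinned.TshotOf_JcPin_eq_TbalOf_zero`; no `def`, no `def … : Prop`,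
nothing cited, 0 sorry.  The dictionary shape `KInv n = K_R − G` is a DISPLAYED HYPOTHESIS `hdict` (road debt X₁ → (D-H)∕(D-Γ)); NOTHING says it
holds.  0∕4 binders of row D1 (hW, hR, D1Tel, D1Rep) discharged; NOT D1, NOT BetaPertH, NOT continuum, NOT Clay.

ABSOLUTE RULE (cell charter, verbatim): «No internally-minted statement may enter as a cited fact. Every hypothesis is either kernel-proved
in this package or a verbatim quotation of a PUBLISHED theorem with page reference. The manuscript(s) under audit are NOT citable for their
own disputed steps — they are the thing under adjudication; programme-internal (2001/route/tribunal) claims are never citable.»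

WHY (`HOME/b2b-balaban-beta-d1-p2/OWNER-MEMO-g4.md` §3 «HOW (K) WILL BE ASSEMBLED», steps (2)+(3)).  Step (2) = part 1: `Π_bm` kills the
bi-gradient gauge term at kernel level.  Step (3) = the dressing adjunction read right-to-left over the R-weighted kernel.  Together, for ANY
spread `K` and ANY spread gauge kernel `G` whose field columns are gradients of block-sum-free functions (multiplier rows zero):
`hessKer (K − G) (vertexOfK (K − G) N (Π_bm J).S) (Π_bm J).W = hessKer K (vertexOfK K N (Π_bm J).S) (Π_bm J).W` for every jet datum `J`
(`Π_bm J := dressBmAt hr J`) — the gauge term is invisible on `Π_bm`-dressed jets.  Since the literal of record IS `Π_bm`-dressed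
(`JsRowD1Pin … = fun j ↦ dressBmAt ρ_c (JsRec0AtOf … j)`, `rfl`) and its first step runs through `KInvStep n 0 = KInv n`, a dictionary of the
displayed shape puts `TbalOf n (JsRowD1Pin …) 0` and the one-shot kernel `TshotOf Lc (JcPin …) m` on the R-weighted legs `K_R` AT ONCE, with
the literal's own jets — the left-hand side of slot (K) in the form the transcription X₃(ii) consumes.

CONTENT.
* §1 `spr_sub`; **`hessKer_sub_gradCols_dressBmAt`** (abstract gauge kernel: `hcol`∕`hinr` of part 1) and
  **`hessKer_sub_biGrad_dressBmAt`** (the (D-Π) shape `G = d∘X∘δ`, block-sum-free columns of `X`).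
* §2 `TbalOf_zero_eq_hessKer_KInv` (any step data: the first step kernel through `KInv n`); **`TbalOf_JsRowD1Pin_zero_of_dictionary`**
  (`hdict : KInv n = K_R − G` ⊢ `TbalOf n (JsRowD1Pin hn N) 0 = hessKer K_R (vertexOfK K_R n (JsRowD1Pin hn N 0).S) (JsRowD1Pin hn N 0).W`);
  **`TshotOf_JcPin_of_dictionary`**, **`shotCoeffPin_of_dictionary`** (the one-shot kernel ∕ coefficient of record over `K_R`); the `gradCols` twins.
Unit `b2b-balaban-beta-d1-formalise-leaf-06` (gen 6), 2026-08-20; claim table `HOME/b2b-balaban-beta-d1-p2/LEAVES-BFx.md` sub-row «D1-BFx-BM-BLIND» (part 2).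
-/

open Finset
open scoped BigOperators
open Literature.MathematicalPhysics.QuantumFieldTheory
open Literature.MathematicalPhysics.QuantumFieldTheory.Balaban1983to89
open Literature.MathematicalPhysics.QuantumFieldTheory.Balaban1983to89.Beta
open ExpKernelCalculus (MKer Decays hessKer)
open HessKerRate (decays_sub)
open AffineAveraging (Form0 box toSite unitVec dz blockSum)
open AveragingContoursRooted (ctrOff ctrOff_mem_box)
open AveragingMixedJetTables (mixFFAt)
open OneStepResolventKernel (Fib JetData KInv)
open OneStepKernelFamily (TbalOf TshotOf TstepOf KInvStep vertexOfK)
open WilsonVertex2Sym (wsym22)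
open Summit.QuantumFields.BalabanUV.Beta.TameKernelCalculus
open Summit.QuantumFields.BalabanUV.Beta.AxialDressingRooted (dressBmAt coDressKBmAt hessKer_dressBmAt)
open Summit.QuantumFields.BalabanUV.Beta.BorderedHessian (KInvStep_zero_eq)
open Summit.QuantumFields.BalabanUV.Beta.RowD1JointEnd (JsRowD1 JsRowD1Pin JsRowD1Pin_eq JsRowD1_eq)
open Summit.QuantumFields.BalabanUV.Beta.SpineRooted (JsRecWAtOf JsRecWAtOf_eq JsRecBmAtOf JsRec0AtOf)
open Summit.QuantumFields.BalabanUV.Beta.D1BFx.FirstStepPinned (JcPin JcPin_apply shotCoeffPin shotCoeffPin_eq TshotOf_JcPin_eq_TbalOf_zero)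
open Summit.QuantumFields.BalabanUV.Beta.D1BFx.BlockMeanBlindness (coDressKBmAt_sub_of_gradCols coDressKBmAt_sub_biGrad)

namespace Summit.QuantumFields.BalabanUV.Beta.D1BFx.BlockMeanBlindnessLegs

noncomputable section

variable {d : ℕ}

/-! ## §1 The gauge term drops out of the Hessian kernel over `Π_bm`-dressed jets -/

section General

/-- [folklore] The difference of two spread kernels is spread (common rate `min`, constant `|C| + |C′|`). -/
theorem spr_sub {K G : MKer (d + 1) (Fib d)} (hK : Spr K) (hG : Spr G) : Spr (K - G) := by
  obtain ⟨C, δ, hδ, hKd⟩ := hK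
  obtain ⟨C', δ', hδ', hGd⟩ := hG
  exact ⟨|C| + |C'|, min δ δ', lt_min hδ hδ',
    decays_sub (decays_of_le hKd (min_le_left _ _)) (decays_of_le hGd (min_le_right _ _))⟩

/-- [folklore] **THE GAUGE TERM DROPS OUT OF THE HESSIAN KERNEL OVER `Π_bm`-DRESSED JETS** (abstract gauge kernel; in-block root): for
spread `K`, `G` with every field column of `G` the gradient of a function with constant block sums and the multiplier rows of `G` zero,
`hessKer (K − G) (vertexOfK (K − G) N (Π_bm J).S) (Π_bm J).W = hessKer K (vertexOfK K N (Π_bm J).S) (Π_bm J).W` (`Π_bm J := dressBmAt hr J`). -/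
theorem hessKer_sub_gradCols_dressBmAt {N : ℕ} [NeZero N] {r : Fin (d + 1) → ℕ} (hr : r ∈ box (d + 1) N) {K G : MKer (d + 1) (Fib d)}
    (hK : Spr K) (hG : Spr G)
    (hcol : ∀ (y : Fin (d + 1) → ℤ) (b : Fib d), ∃ (f : Form0 (d + 1) ℝ) (c : ℝ),
      (∀ Y, blockSum N f Y = c) ∧ ∀ κ z, G z y (Sum.inl κ) b = dz f κ z)
    (hinr : ∀ (x y : Fin (d + 1) → ℤ) (m : Fin (d + 1)) (b : Fib d), G x y (Sum.inr m) b = 0) (J : JetData d N) :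
    hessKer (K - G) (vertexOfK (K - G) N (dressBmAt hr J).S) (dressBmAt hr J).W =
      hessKer K (vertexOfK K N (dressBmAt hr J).S) (dressBmAt hr J).W := by
  have hN : 1 ≤ N := Nat.one_le_iff_ne_zero.mpr (NeZero.ne N)
  obtain ⟨C, δ, hδ, hKd⟩ := id hK
  obtain ⟨C', δ', hδ', hKGd⟩ := spr_sub hK hG
  rw [hessKer_dressBmAt hr ⟨δ', |C'|, hδ', abs_nonneg C', decays_of_le hKGd le_rfl⟩ J,
    hessKer_dressBmAt hr ⟨δ, |C|, hδ, abs_nonneg C, decays_of_le hKd le_rfl⟩ J,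
    coDressKBmAt_sub_of_gradCols hN hr hK.tame hG.tame hcol hinr]

/-- [folklore] **THE SAME FOR THE (D-Π) SHAPE `G = d∘X∘δ`** — a scalar kernel `X` with block-sum-free COLUMNS; `G` any fibred kernel whose
field–field block is the bi-gradient of `X` and whose other blocks vanish. -/
theorem hessKer_sub_biGrad_dressBmAt {N : ℕ} [NeZero N] {r : Fin (d + 1) → ℕ} (hr : r ∈ box (d + 1) N) {K G : MKer (d + 1) (Fib d)}
    (hK : Spr K) (hG : Spr G)
    {X : (Fin (d + 1) → ℤ) → (Fin (d + 1) → ℤ) → ℝ} (hX : ∀ y' Y, blockSum N (fun w => X w y') Y = 0)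
    (hGe : ∀ x y κ l, G x y (Sum.inl κ) (Sum.inl l) = X (x + unitVec κ) (y + unitVec l) - X (x + unitVec κ) y - X x (y + unitVec l) + X x y)
    (hG0r : ∀ x y m b, G x y (Sum.inr m) b = 0) (hG0c : ∀ x y κ m, G x y (Sum.inl κ) (Sum.inr m) = 0) (J : JetData d N) :
    hessKer (K - G) (vertexOfK (K - G) N (dressBmAt hr J).S) (dressBmAt hr J).W =
      hessKer K (vertexOfK K N (dressBmAt hr J).S) (dressBmAt hr J).W := by
  have hN : 1 ≤ N := Nat.one_le_iff_ne_zero.mpr (NeZero.ne N)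
  obtain ⟨C, δ, hδ, hKd⟩ := id hK
  obtain ⟨C', δ', hδ', hKGd⟩ := spr_sub hK hG
  rw [hessKer_dressBmAt hr ⟨δ', |C'|, hδ', abs_nonneg C', decays_of_le hKGd le_rfl⟩ J,
    hessKer_dressBmAt hr ⟨δ, |C|, hδ, abs_nonneg C, decays_of_le hKd le_rfl⟩ J,
    coDressKBmAt_sub_biGrad hN hr hK.tame hG.tame hX hGe hG0r hG0c]

end General

/-! ## §2 At the literal of record: the first step ∕ the one-shot kernel over the R-weighted legs, CONDITIONAL on the dictionary SHAPE -/

section Literal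

/-- [folklore] **THE FIRST STEP KERNEL OF ANY STEP DATA RUNS THROUGH `KInv n`** (`KInvStep n 0 = KInv n`):
`TbalOf n Js 0 = hessKer (KInv n) (vertexOfK (KInv n) n (Js 0).S) (Js 0).W`. -/
theorem TbalOf_zero_eq_hessKer_KInv {n : ℕ} [NeZero n] (Js : ℕ → JetData 3 n) :
    TbalOf n Js 0 = hessKer (KInv (N := n) (d := 3)) (vertexOfK (KInv (N := n) (d := 3)) n (Js 0).S) (Js 0).W := by
  show TstepOf n 0 (Js 0) = _
  unfold TstepOf
  rw [KInvStep_zero_eq]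

variable {n : ℕ} [NeZero n]

/-- [folklore] **THE FIRST STEP OF THE LITERAL OF RECORD OVER THE R-WEIGHTED LEGS, CONDITIONAL ON THE DICTIONARY SHAPE** (odd `n`; abstract
gauge kernel): IF `KInv n = K_R − G` with spread `K_R`, `G` and `G`'s field columns gradients of functions with constant block sums
(multiplier rows zero) — the SHAPE (D-Γ) predicts, NOT asserted — THEN
`TbalOf n (JsRowD1Pin hn N) 0 = hessKer K_R (vertexOfK K_R n (JsRowD1Pin hn N 0).S) (JsRowD1Pin hn N 0).W`. -/
theorem TbalOf_JsRowD1Pin_zero_of_dictionary_gradCols (hn : Odd n) (N : ℕ) {KR G : MKer (3 + 1) (Fib 3)}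
    (hdict : KInv (N := n) (d := 3) = KR - G) (hK : Spr KR) (hG : Spr G)
    (hcol : ∀ (y : Fin (3 + 1) → ℤ) (b : Fib 3), ∃ (f : Form0 (3 + 1) ℝ) (c : ℝ),
      (∀ Y, blockSum n f Y = c) ∧ ∀ κ z, G z y (Sum.inl κ) b = dz f κ z)
    (hinr : ∀ (x y : Fin (3 + 1) → ℤ) (m : Fin (3 + 1)) (b : Fib 3), G x y (Sum.inr m) b = 0) :
    TbalOf n (JsRowD1Pin hn N) 0 = hessKer KR (vertexOfK KR n (JsRowD1Pin hn N 0).S) (JsRowD1Pin hn N 0).W := by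
  rw [TbalOf_zero_eq_hessKer_KInv, hdict, JsRowD1Pin_eq, JsRowD1_eq, JsRecWAtOf_eq]
  unfold SpineRooted.JsRecBmAtOf
  exact hessKer_sub_gradCols_dressBmAt (ctrOff_mem_box hn.pos) hK hG hcol hinr _

/-- [folklore] **THE SAME FOR THE (D-Π) SHAPE `KInv n = K_R − d∘X∘δ`** (block-sum-free columns of the scalar kernel `X`; e.g. the shape of
`Gam = Γ_R − d∘𝔅∘δ`, `𝔅` block-sum-free by `BiLaplaceBlockKKT.Sb_M` — NOT asserted here). -/
theorem TbalOf_JsRowD1Pin_zero_of_dictionary (hn : Odd n) (N : ℕ) {KR G : MKer (3 + 1) (Fib 3)}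
    (hdict : KInv (N := n) (d := 3) = KR - G) (hK : Spr KR) (hG : Spr G)
    {X : (Fin (3 + 1) → ℤ) → (Fin (3 + 1) → ℤ) → ℝ} (hX : ∀ y' Y, blockSum n (fun w => X w y') Y = 0)
    (hGe : ∀ x y κ l, G x y (Sum.inl κ) (Sum.inl l) = X (x + unitVec κ) (y + unitVec l) - X (x + unitVec κ) y - X x (y + unitVec l) + X x y)
    (hG0r : ∀ x y m b, G x y (Sum.inr m) b = 0) (hG0c : ∀ x y κ m, G x y (Sum.inl κ) (Sum.inr m) = 0) :
    TbalOf n (JsRowD1Pin hn N) 0 = hessKer KR (vertexOfK KR n (JsRowD1Pin hn N 0).S) (JsRowD1Pin hn N 0).W := by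
  rw [TbalOf_zero_eq_hessKer_KInv, hdict, JsRowD1Pin_eq, JsRowD1_eq, JsRecWAtOf_eq]
  unfold SpineRooted.JsRecBmAtOf
  exact hessKer_sub_biGrad_dressBmAt (ctrOff_mem_box hn.pos) hK hG hX hGe hG0r hG0c _

end Literal

section OneShot

variable {Lc : ℕ} [NeZero Lc]

/-- [folklore] **THE ONE-SHOT KERNEL OF RECORD OVER THE R-WEIGHTED LEGS AT BLOCKING `Lc^m`, CONDITIONAL ON THE DICTIONARY SHAPE**:
`hdict : KInv (Lc^m) = K_R − d∘X∘δ` ⊢ `TshotOf Lc (JcPin hLc N) m = hessKer K_R (vertexOfK K_R (Lc^m) (JcPin hLc N m).S) (JcPin hLc N m).W` —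
slot (K)'s left-hand side on the SAME legs as the road's tables, with the literal's own (dressed) jets. -/
theorem TshotOf_JcPin_of_dictionary (hLc : Odd Lc) (N m : ℕ) {KR G : MKer (3 + 1) (Fib 3)}
    (hdict : KInv (N := Lc ^ m) (d := 3) = KR - G) (hK : Spr KR) (hG : Spr G)
    {X : (Fin (3 + 1) → ℤ) → (Fin (3 + 1) → ℤ) → ℝ} (hX : ∀ y' Y, blockSum (Lc ^ m) (fun w => X w y') Y = 0)
    (hGe : ∀ x y κ l, G x y (Sum.inl κ) (Sum.inl l) = X (x + unitVec κ) (y + unitVec l) - X (x + unitVec κ) y - X x (y + unitVec l) + X x y)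
    (hG0r : ∀ x y m' b, G x y (Sum.inr m') b = 0) (hG0c : ∀ x y κ m', G x y (Sum.inl κ) (Sum.inr m') = 0) :
    TshotOf Lc (JcPin hLc N) m = hessKer KR (vertexOfK KR (Lc ^ m) (JcPin hLc N m).S) (JcPin hLc N m).W := by
  rw [TshotOf_JcPin_eq_TbalOf_zero, JcPin_apply]
  exact TbalOf_JsRowD1Pin_zero_of_dictionary (n := Lc ^ m) hLc.pow N hdict hK hG hX hGe hG0r hG0c

/-- [folklore] The same with the abstract gauge-kernel hypotheses of part 1 (`hcol` ∕ `hinr`). -/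
theorem TshotOf_JcPin_of_dictionary_gradCols (hLc : Odd Lc) (N m : ℕ) {KR G : MKer (3 + 1) (Fib 3)}
    (hdict : KInv (N := Lc ^ m) (d := 3) = KR - G) (hK : Spr KR) (hG : Spr G)
    (hcol : ∀ (y : Fin (3 + 1) → ℤ) (b : Fib 3), ∃ (f : Form0 (3 + 1) ℝ) (c : ℝ),
      (∀ Y, blockSum (Lc ^ m) f Y = c) ∧ ∀ κ z, G z y (Sum.inl κ) b = dz f κ z)
    (hinr : ∀ (x y : Fin (3 + 1) → ℤ) (m' : Fin (3 + 1)) (b : Fib 3), G x y (Sum.inr m') b = 0) :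
    TshotOf Lc (JcPin hLc N) m = hessKer KR (vertexOfK KR (Lc ^ m) (JcPin hLc N m).S) (JcPin hLc N m).W := by
  rw [TshotOf_JcPin_eq_TbalOf_zero, JcPin_apply]
  exact TbalOf_JsRowD1Pin_zero_of_dictionary_gradCols (n := Lc ^ m) hLc.pow N hdict hK hG hcol hinr

/-- [folklore] **THE ONE-SHOT COEFFICIENT OF RECORD OVER THE R-WEIGHTED LEGS** (same hypotheses):
`shotCoeffPin hLc N m μ ν = secondMoment (hessKer K_R (vertexOfK K_R (Lc^m) (JcPin hLc N m).S) (JcPin hLc N m).W) μ ν`. -/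
theorem shotCoeffPin_of_dictionary (hLc : Odd Lc) (N m : ℕ) (μ ν : Fin 4) {KR G : MKer (3 + 1) (Fib 3)}
    (hdict : KInv (N := Lc ^ m) (d := 3) = KR - G) (hK : Spr KR) (hG : Spr G)
    {X : (Fin (3 + 1) → ℤ) → (Fin (3 + 1) → ℤ) → ℝ} (hX : ∀ y' Y, blockSum (Lc ^ m) (fun w => X w y') Y = 0)
    (hGe : ∀ x y κ l, G x y (Sum.inl κ) (Sum.inl l) = X (x + unitVec κ) (y + unitVec l) - X (x + unitVec κ) y - X x (y + unitVec l) + X x y)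
    (hG0r : ∀ x y m' b, G x y (Sum.inr m') b = 0) (hG0c : ∀ x y κ m', G x y (Sum.inl κ) (Sum.inr m') = 0) :
    shotCoeffPin hLc N m μ ν = B12Beta.secondMoment (hessKer KR (vertexOfK KR (Lc ^ m) (JcPin hLc N m).S) (JcPin hLc N m).W) μ ν := by
  rw [shotCoeffPin_eq, TshotOf_JcPin_of_dictionary hLc N m hdict hK hG hX hGe hG0r hG0c]

end OneShot

end

end Summit.QuantumFields.BalabanUV.Beta.D1BFx.BlockMeanBlindnessLegs
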